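import Summits.QuantumFields.GaugeBoot.Rows.GLYZc2D4Labels
import Summits.QuantumFields.GaugeBoot.Rows.GLYZc1D4BindGen
import Summits.QuantumFields.GaugeBoot.Eqs.BindKitZ
import HarnessLib

/-!
# Gauge-boot: CODED torus-binding lemma for the GLYZc2D4 certificate replays (integer-coded equality rows)

Cell `pub-gaugeboot` (HOME `run/shared/lean/pub/pub-gaugeboot/`), seat lean1 (binding layer; FANOUT-PLAN A126 (2), A148 (2), A155 (2)).

HONEST FRAMING (page 1 of every file of this cell): certified bounds on lattice expectations at STATED coupling,
gauge group, dimension and torus size; NOT a mass gap, NOT a continuum limit, NOT a string tension, NOT large `N`.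
The venture is explicitly NOT Yang–Mills-summit-bearing (barriers `FixedCouplingUltralocality`,
`PerturbativeInvisibility`).

lean3's certificate halves state the equality rows of a GLYZc2D4 problem file as sparse column rows `(rhs, [(column, coefficient), …])`;
lean2's per-β modules prove the same rows INTEGER-CODED (`Eqs/BindKitZ`: terms `(label code, z)`, common denominator `M`, word =
`BindN.wdg 4 code`) for the torus state (`rowSum4 … = 0`).  As for glyz-c2-rp-3D (`GLYZc2D3BindGenC`): lean1's labels are digit codes
(`GLYZc2D4.labelCode`, decoder `GLYZc2D4.dw`), the two decoders agree on all 4480 labels (`labelN_eq_wdg`, kernel), so the per-row check compares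
(CODE, coefficient) pairs only — `rowOKCZ` (rhs `0`, columns strictly increasing `< NV`, coded permutation), `heq_of_rowsOKCZ`.
-/

noncomputable section

open Literature.MathematicalPhysics.QuantumFieldTheory
open Summit.QuantumFields.GaugeBoot.Certificates Summit.QuantumFields.GaugeBoot.Certificates.Sparse

namespace Summit.QuantumFields.GaugeBoot

namespace GLYZc2D4

/-! ## The two digit-code decoders agree on the labels -/

set_option maxRecDepth 100000 in
set_option maxHeartbeats 0 in
/-- Kernel check, columns `0 ≤ v < 1120` (the bounded quantifier over `v < 1120` needs a raised `maxRecDepth`). -/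
theorem labelN_eq_wdg_0 : ∀ v < 1120, labelN v = BindN.wdg 4 (labelCode v) := by
  decide +kernel

set_option maxRecDepth 100000 in
set_option maxHeartbeats 0 in
/-- Kernel check, columns `1120 ≤ v < 2240` (the bounded quantifier over `v < 2240` needs a raised `maxRecDepth`). -/
theorem labelN_eq_wdg_1 : ∀ v < 2240, 1120 ≤ v → labelN v = BindN.wdg 4 (labelCode v) := by
  decide +kernel

set_option maxRecDepth 100000 in
set_option maxHeartbeats 0 in
/-- Kernel check, columns `2240 ≤ v < 3360` (the bounded quantifier over `v < 3360` needs a raised `maxRecDepth`). -/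
theorem labelN_eq_wdg_2 : ∀ v < 3360, 2240 ≤ v → labelN v = BindN.wdg 4 (labelCode v) := by
  decide +kernel

set_option maxRecDepth 100000 in
set_option maxHeartbeats 0 in
/-- Kernel check, columns `3360 ≤ v < 4480` (the bounded quantifier over `v < 4480` needs a raised `maxRecDepth`). -/
theorem labelN_eq_wdg_3 : ∀ v < 4480, 3360 ≤ v → labelN v = BindN.wdg 4 (labelCode v) := by
  decide +kernel

/-- **The label words through lean2's decoder**: `labelN v = BindN.wdg 4 (labelCode v)` for every column `v < 4480`. -/
theorem labelN_eq_wdg (v : ℕ) (hv : v < 4480) : labelN v = BindN.wdg 4 (labelCode v) := by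
  rcases Nat.lt_or_ge v 1120 with g0 | g0
  · exact labelN_eq_wdg_0 v g0
  rcases Nat.lt_or_ge v 2240 with g1 | g1
  · exact labelN_eq_wdg_1 v g1 g0
  rcases Nat.lt_or_ge v 3360 with g2 | g2
  · exact labelN_eq_wdg_2 v g2 g1
  exact labelN_eq_wdg_3 v hv g2

/-! ## The coded per-row data check -/

/-- Column check of a sparse row in one pass: columns strictly increasing and `< 4480`. -/
def colsOK : List (ℕ × ℚ) → Bool
  | [] => true
  | [p] => decide (p.1 < 4480)
  | p :: q :: rest => decide (p.1 < q.1) && decide (p.1 < 4480) && colsOK (q :: rest)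

/-- `colsOK` gives pairwise `<` of the columns (hence distinctness) and the range bound. -/
theorem colsOK_sound : ∀ l : List (ℕ × ℚ), colsOK l = true →
    (l.map Prod.fst).Pairwise (· < ·) ∧ ∀ p ∈ l, p.1 < 4480
  | [], _ => by simp
  | [p], h => by simpa [colsOK] using h
  | p :: q :: rest, h => by
    simp only [colsOK, Bool.and_eq_true, decide_eq_true_eq] at h
    obtain ⟨⟨hpq, hp⟩, hrest⟩ := h
    obtain ⟨hpw, hlt⟩ := colsOK_sound (q :: rest) hrest
    refine ⟨?_, ?_⟩
    · rw [List.map_cons, List.pairwise_cons]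
      refine ⟨fun b hb => ?_, hpw⟩
      rw [List.map_cons, List.mem_cons] at hb
      rcases hb with hb | hb
      · rw [hb]; exact hpq
      · rw [List.map_cons, List.pairwise_cons] at hpw
        exact lt_trans hpq (hpw.1 b hb)
    · intro r hr
      rcases List.mem_cons.mp hr with hr | hr
      · rw [hr]; exact hp
      · exact hlt r hr

/-- A sparse problem row with its columns replaced by the label CODES: `[(labelCode v, c), …]`. -/
def rwCodes (r : List (ℕ × ℚ)) : List (ℕ × ℚ) := r.map fun p => (labelCode p.1, p.2)

/-- lean2's integer-coded terms `(code, z)` with common denominator `M` as `(code, z / M)` pairs. -/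
def tCodesZ (ts : List (ℕ × ℤ)) (M : ℕ) : List (ℕ × ℚ) := ts.map fun t => (t.1, (t.2 : ℚ) / M)

/-- **The coded per-row data check**: right-hand side `0`, columns strictly increasing and `< 4480`, and the label-coded sparse
row is a permutation of lean2's coded row (pairs of a natural and a rational; no word decoding). -/
def rowOKCZ (rw : ℚ × List (ℕ × ℚ)) (ts : List (ℕ × ℤ)) (M : ℕ) : Bool :=
  decide (rw.1 = 0) && colsOK rw.2 && decide ((rwCodes rw.2).Perm (tCodesZ ts M))

/-- lean2's decoded row, as (word, coefficient) pairs, is the coded row read through `BindN.wdg 4`. -/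
theorem ePairs_decWZ (ts : List (ℕ × ℤ)) (M : ℕ) :
    GLYZc1D4.ePairs (BindZ.decWZ 4 ts M) = (tCodesZ ts M).map fun q => (BindN.wdg 4 q.1, q.2) := by
  simp [GLYZc1D4.ePairs, BindZ.decWZ, tCodesZ, List.map_map, Function.comp_def]

/-- The `c1` components of a decoded coded row vanish. -/
theorem decWZ_c1 (ts : List (ℕ × ℤ)) (M : ℕ) : ∀ t ∈ BindZ.decWZ 4 ts M, t.2.2 = 0 := by
  intro t ht
  simp only [BindZ.decWZ, List.mem_map] at ht
  obtain ⟨s, _, rfl⟩ := ht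
  rfl

variable (β : ℝ) (L : ℕ) [NeZero L]

/-- **From the coded data check to lean3's `heq`**: if every sparse row `rows e` (`e < N`) passes `rowOKCZ` against a coded row
`crow e` (denominator `cM e`) whose decoding vanishes on the torus state (`rowSum4 β L (BindZ.decWZ 4 (crow e) (cM e)) = 0`, lean2),
then `Σ_v (rows e)_v · y β L v = rhs_e`. -/
theorem heq_of_rowsOKCZ {N : ℕ} (rows : ℕ → ℚ × List (ℕ × ℚ)) (crow : ℕ → List (ℕ × ℤ)) (cM : ℕ → ℕ)
    (hok : ∀ e < N, rowOKCZ (rows e) (crow e) (cM e) = true)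
    (hE : ∀ e < N, rowSum4 β L (BindZ.decWZ 4 (crow e) (cM e)) = 0) (e : Fin N) :
    ∑ v : Fin 4480, (sget (rows e.val).2 v.val : ℝ) * y β L v = ((rows e.val).1 : ℝ) := by
  have hok' := hok e.val e.isLt
  simp only [rowOKCZ, Bool.and_eq_true, decide_eq_true_eq] at hok'
  obtain ⟨⟨hrhs, hcols⟩, hperm⟩ := hok'
  obtain ⟨hpw, hlt⟩ := colsOK_sound _ hcols
  have hnd : ((rows e.val).2.map Prod.fst).Nodup := hpw.imp fun h => Nat.ne_of_lt h
  rw [hrhs, Rat.cast_zero]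
  have hy : ∀ v : Fin 4480, y β L v = Rung0D4.W β L (labelN v.val) := fun v => rfl
  simp only [hy]
  rw [GLYZc1D3.sum_sget_mul (fun k => Rung0D4.W β L (labelN k)) _ hnd fun p hp => hlt p hp]
  have hmap : ((rows e.val).2.map fun p => (p.2 : ℝ) * Rung0D4.W β L (labelN p.1)) =
      (rwCodes (rows e.val).2).map fun q => (q.2 : ℝ) * Rung0D4.W β L (BindN.wdg 4 q.1) := by
    rw [rwCodes, List.map_map]
    refine List.map_congr_left fun p hp => ?_
    simp only [Function.comp_apply]
    rw [labelN_eq_wdg p.1 (hlt p hp)]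
  rw [hmap, (hperm.map _).sum_eq]
  have hmap2 : ((tCodesZ (crow e.val) (cM e.val)).map fun q => (q.2 : ℝ) * Rung0D4.W β L (BindN.wdg 4 q.1)) =
      (GLYZc1D4.ePairs (BindZ.decWZ 4 (crow e.val) (cM e.val))).map fun q => (q.2 : ℝ) * Rung0D4.W β L q.1 := by
    rw [ePairs_decWZ, List.map_map]; rfl
  rw [hmap2, GLYZc1D4.sum_ePairs β L _ (decWZ_c1 _ _)]
  exact hE e.val e.isLt

end GLYZc2D4

end Summit.QuantumFields.GaugeBoot

end
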